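import Literature.Claims.NS.Guevremont2026
import Summits.NavierStokesRegularity.NavierStokesRegularity.Theorems.SoloRefuteRomanMiller2011
import HarnessLib

/-!
# C143 `Guevremont2026` — the Clay-link binder `Step1_EnergyEq` is false AS TYPED (CLAY-LINK keeper kit, lit-4 g8)

`Literature.Claims.NS.Guevremont2026.clay_of_claimed' (h : ClaimedTheorem) (h1 : Step1_EnergyEq) :
clayR3.Regularity` (rev §I, p528602) takes the paper's «strict energy equality» §3.3 p.5 l.21–31 typed
along EVERY smooth solution of (1)–(2) on `ℝ³ × [0,T)` from a datum of the class (`IsSolution`: classical,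
no condition at `|x| → ∞`; typist's own flag: «at the printed grain … not a tree theorem»). At that width the
statement is false in the kernel: the uniformly accelerating stream `u(t, x) = t·e₀`, `p(t, x) = −x₀` (the
tree's `RomanMiller2011.stream id` / `streamPressure id`, a classical Navier–Stokes flow on all of
space-time for every `ν`) starts from the zero datum — smooth, divergence-free, in every `H^s` (the file's own
`inHs_of_hasRapidSpatialDecay`) — and at `t = 1 < T = 2` the left-hand side `∫|u(1)|² + 2ν∫∫|∇u|²` is `∞`
while `∫|u₀|² = 0`. Hence `¬ Step1_EnergyEq`: the Clay link of C143 is satisfied VACUOUSLY in `h1`, exactly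
as C163 `Seo2025`'s is in its energy binder (sibling kit `SoloRefuteSeo2025Energy`). Records-grade: Step 1 is
«consumed only by the Clay link» (skeleton docstring), not by the printed proof's head `Step3_EnstrophyLaw` of
#131±; no verdict / class / locator is touched and nothing is re-keyed.

WHAT THIS IS NOT: not a claim about NS regularity or blow-up; not a claim about any author beyond the
typed locator.
-/

set_option linter.dupNamespace false

noncomputable section

open Set Function MeasureTheory
open scoped ContDiff ENNReal
open Literature.Analysis.FluidPDE Literature.Claims.NS.Guevremont2026
open Summit.NavierStokesRegularity.NavierStokesRegularity.Theorems.RomanMiller2011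
  (e0 stream streamPressure isClassicalNSSolutionOn_stream)

namespace Summit.NavierStokesRegularity.NavierStokesRegularity.Theorems.Guevremont2026Energy

/-- The stream `t·e₀` starts from the zero datum. [folklore] -/
theorem stream_id_zero : stream id 0 = 0 := by
  funext x
  simp [stream]

/-- At time `1` the stream is the constant unit field `e₀`, of pointwise energy density `1`. [folklore] -/
theorem enorm_sq_stream_id_one (x : E3) : ‖stream id 1 x‖ₑ ^ 2 = 1 := by
  have h1 : ‖stream id 1 x‖ = 1 := by
    simp [stream, e0]
  rw [← ofReal_norm, h1]
  simp

/-- `∫ |u(x,1)|² dx = ∞` for the stream on `ℝ³`. [folklore] -/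
theorem lintegral_enorm_sq_stream_id_one : ∫⁻ x, ‖stream id 1 x‖ₑ ^ 2 = ⊤ := by
  have hvol : (volume : Measure E3) univ = ⊤ := by simp
  simp_rw [enorm_sq_stream_id_one]
  rw [lintegral_const, hvol]
  simp

/-- The zero field is a datum of the class at every Sobolev index `s`. [folklore] -/
theorem isDatum_zero (s : ℝ) : IsDatum s (0 : E3 → E3) := by
  have hdec : HasRapidSpatialDecay (0 : E3 → E3) := fun n K => ⟨0, fun x => by simp⟩
  refine ⟨contDiff_const, fun x => ?_, inHs_of_hasRapidSpatialDecay contDiff_const hdec s⟩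
  simp [VectorCalculus.divergence]

/-- The stream is a «smooth solution on `ℝ³ × [0,2)`» of the class from the zero datum, for every `ν`. [folklore] -/
theorem isSolution_stream (ν : ℝ) : IsSolution ν 2 (0 : E3 → E3) (stream id) (streamPressure id) where
  isClassical :=
    (isClassicalNSSolutionOn_stream contDiff_id ν).mono (subset_univ _) (uniqueDiffOn_Ico 0 2)
  initial := stream_id_zero

/-- **Step 1 as typed (`Step1_EnergyEq`) is false.** Witness: `ν = 1`, `s = 1`, `T = 2`, the zero datum, the
uniformly accelerating stream, `t = 1`: left-hand side `= ∞`, right-hand side `= 0`.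
[cite: Guevremont2026, §3.3 p.5 l.21–31] -/
theorem not_step1_EnergyEq : ¬ Step1_EnergyEq := by
  intro h
  have h1 := h 1 one_pos 1 (by norm_num) 2 0 (stream id) (streamPressure id) (isDatum_zero 1)
    (isSolution_stream 1) 1 ⟨zero_le_one, by norm_num⟩
  rw [lintegral_enorm_sq_stream_id_one, top_add] at h1
  have h0 : ∫⁻ x, ‖(0 : E3 → E3) x‖ₑ ^ 2 = 0 := by simp
  exact ENNReal.top_ne_zero (h1.trans h0)

/-- FQN guard: the refuted statement is literally the skeleton's. -/
example : ¬ Literature.Claims.NS.Guevremont2026.Step1_EnergyEq := not_step1_EnergyEq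

end Summit.NavierStokesRegularity.NavierStokesRegularity.Theorems.Guevremont2026Energy

end

-- WHAT THIS IS NOT: not a claim about NS regularity or blow-up; not a claim about any author beyond the typed locator.
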